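/-
Copyright (c) 2026 the pub-hodgecm-mathlib formalisation cell (harness21).  Prover seat hodgecm-mathlib-K2E4-p14 (g9), Track B ∕ K2-LIT, h413 = `stmt-HodgeConjecture-24833`,
line `K2_E1_TraceFormulaBeta`, campaign «EIS-R7-BL-SPH-3» — THE MAASS–SELBERG LETTERS ON THE REAL AXIS, FILE 1 (dealer K2E1-plan (g7) (200); this seat's report 12:17Z): the
real-variable analysis that pays (MS-P) at REAL points and (MS-2) at `z₀ = 2` for the spherical truncated Eisenstein family of `U(2,1)∕CM` (no automorphic objects in this file).
-/
import Mathlib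
import Literature.NumberTheory.EllipticCurves.Gamma1NewformFunctionalEquationProofs   -- ★ `conj_ofReal_cpow` (reused, not restated)
import HarnessLib

/-!
# K2·E1 — `K2E1MaassSelbergDiagonalRealAxisCMThree`: the diagonal Maass–Selberg four-term `R(z, z; c̃)` is bounded near EVERY point of `{1 < Re}` off `2`, and `|z − 2|²·R` near `2`

Track B ∕ K2-LIT, crux h413 = `stmt-HodgeConjecture-24833`, route of record `HCCMUnconditional`; cell `hodgecm-mathlib`, squad K2, ENGINE E1, campaign EIS-R7-BL-SPH-3.  THEOREMS ONLY
(no `def`, no `instance`, no notation, no named-fact hypothesis, no `sorry`); lane `--supports stmt-HodgeConjecture-24833 --as helper` (count-neutral).  Closes no socket.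

THE MATHEMATICS [MoeglinWaldspurger1995, IV.2.3, IV.3.12 (a); Arthur1980TraceFormulaII, §4].  On the diagonal the continued Maass–Selberg relation of the rank-one truncated Eisenstein
family reads `‖Λ^T Ẽ(z)‖² = R(z, z; c̃(z))` with the four-term
`R = Cμ·CK·( T^{z+z̄−2}∕(z+z̄−2)·κm|φ₀|² + T^{z−z̄}∕(z−z̄)·κm φ₀·conj(c̃ z φ₀) − T^{−(z−z̄)}∕(z−z̄)·κm c̃ z φ₀ conj φ₀ − T^{−(z+z̄−2)}∕(z+z̄−2)·κm c̃ z φ₀ conj(c̃ z φ₀) )`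
(★ `K2E1MaassSelbergDiagonalFourTermCMThree.normSq_family_eq_fourTerm_on'`).  Term by term the two middle summands carry `1∕|Im z|`; but they COMBINE:
`R = Cμ CK κ m |φ₀|² · ( T^{2x−2}∕(2x−2) + (conj k − k)∕(z − z̄) − T^{−(2x−2)}∕(2x−2)·|c̃ z|² )`, `k(z) := T^{−(z−z̄)}·c̃(z)` (§2, an exact identity), and
`‖(conj k − k)∕(z − z̄)‖ = |Im k(z)|∕|Im z|`.  When `c̃` is REAL ON THE REAL AXIS (reflection principle — it is an integral of positive reals on the tube) the `ℝ`-smooth `k` is real on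
the real axis, so `|Im k(x+iy)| ≤ C|y|` near every real point (§1: `C¹ ⇒` locally Lipschitz, Mathlib `ContDiffAt.exists_lipschitzOnWith`, compare with the real foot point `x = Re z`).
Hence `R(z, z; c̃)` is BOUNDED near every `z₀` with `1 < Re z₀` at which `c̃` is analytic (§3, real or not), and `|z − 2|²·R` is bounded near `z₀ = 2` where `c̃` has its simple pole
(`(z−2)c̃ = d` analytic at `2`, `k₂ := conj(z−2)·T^{−(z−z̄)}·d` real on the real axis).  §4 is the small closure step used downstream: an eventual bound off the real axis plus
continuity gives the eventual bound everywhere.  FILE 2 (`…DiagonalLowerCMThree`) supplies the diagonal identity on the LOWER half-plane and the reflection principle; FILE 3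
(`K2E1SphericalEisensteinL2BoundCMThree`) pays (MS-P)∕(MS-2) of ★ `sphericalEisenstein_continuation_cm_three_of_road` (K2E4-p14 (g8), p859972); FILE 4 is the letter-free capstone₃.
* §1 `exists_abs_im_le_mul_abs_im` — `C¹` at a real point + real on the punctured real trace ⇒ `|Im k z| ≤ C·|Im z|` near it.
* §2 `norm_cpow_neg_sub_conj`, `contDiff_cpow_neg_sub_conj`, `norm_conj_sub_self_div`, **`fourTerm_diag_eq`** (the exact recombination), `norm_fourTerm_diag_le`.
* §3 HEADS **`exists_norm_fourTerm_diag_le`** (near `z₀`, `1 < Re z₀`, `c̃` analytic at `z₀`, real on the real trace if `z₀` is real) and **`exists_normSq_mul_norm_fourTerm_diag_le_two`**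
  (the `|z−2|²`-weighted bound at `2`).
* §4 `eventually_norm_le_of_im_ne_zero` — closure across the real axis by continuity.
HONEST LABEL: HC_CM is proved only modulo the 7 printed citations (2 remaining named inputs: hLiu418 = `stmt-HodgeConjecture-24832`, h413 = `stmt-HodgeConjecture-24833`) until rung 0
closes; this file asserts no named fact and closes no socket; count-neutral; unconditional.

## References
* [MoeglinWaldspurger1995] C. Mœglin, J.-L. Waldspurger, *Spectral decomposition and Eisenstein series* (1995), IV.2.3, IV.3.12 (a).
* [Arthur1980TraceFormulaII] J. Arthur, *A trace formula for reductive groups II*, Compositio Math. 40 (1980), §4.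
-/

set_option autoImplicit false
-- the mandated namespace repeats the single-problem summit's segment (`HodgeConjecture.HodgeConjecture`)
set_option linter.dupNamespace false

noncomputable section

open Set Filter Topology Metric Complex
open scoped ComplexConjugate
open Literature.NumberTheory.EllipticCurves.ModularForms (conj_ofReal_cpow)

namespace Summit.HodgeConjecture.HodgeConjecture.Cruxes.H413.K2E1MaassSelbergDiagonalRealAxisCMThree

/-! ## §1 A `C¹` function real on the real axis has imaginary part `O(|Im z|)` near a real point -/

/-- **`|Im k(z)| ≤ C·|Im z|` NEAR A REAL POINT** for `k : ℂ → ℂ` which is `ℝ`-`C¹` at `x₀ ∈ ℝ` and real at the real points `x ≠ x₀` near `x₀` (hence at `x₀` by continuity):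
`k` is Lipschitz near `x₀` (Mathlib `ContDiffAt.exists_lipschitzOnWith`) and `Im k(z) = Im (k(z) − k(Re z))`, `‖z − Re z‖ = |Im z|`. [folklore] -/
theorem exists_abs_im_le_mul_abs_im {k : ℂ → ℂ} {x₀ : ℝ} (hk : ContDiffAt ℝ 1 k (x₀ : ℂ))
    (hreal : ∀ᶠ x : ℝ in 𝓝[≠] x₀, (k (x : ℂ)).im = 0) :
    ∃ C : ℝ, ∀ᶠ z in 𝓝 (x₀ : ℂ), |(k z).im| ≤ C * |z.im| := by
  obtain ⟨K, t, ht, hK⟩ := hk.exists_lipschitzOnWith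
  -- the value at `x₀` is real too
  have hk0 : (k (x₀ : ℂ)).im = 0 := by
    have h1 : Tendsto (fun x : ℝ => (k (x : ℂ)).im) (𝓝[≠] x₀) (𝓝 ((k (x₀ : ℂ)).im)) :=
      (continuous_im.continuousAt.tendsto.comp (hk.continuousAt.tendsto.comp
        ((continuous_ofReal.tendsto x₀).mono_left nhdsWithin_le_nhds)))
    exact tendsto_nhds_unique h1 (tendsto_const_nhds.congr' (hreal.mono fun x hx => hx.symm))
  obtain ⟨r₁, hr₁, hr₁t⟩ := Metric.mem_nhds_iff.1 ht
  obtain ⟨r₂, hr₂, hr₂real⟩ : ∃ r₂ > 0, ∀ x : ℝ, dist x x₀ < r₂ → x ≠ x₀ → (k (x : ℂ)).im = 0 := by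
    obtain ⟨r₂, hr₂, h⟩ := Metric.mem_nhdsWithin_iff.1 hreal
    exact ⟨r₂, hr₂, fun x hx hne => h ⟨hx, hne⟩⟩
  refine ⟨K, ?_⟩
  filter_upwards [Metric.ball_mem_nhds (x₀ : ℂ) (lt_min hr₁ hr₂)] with z hz
  have hzr : ‖z - (x₀ : ℂ)‖ < min r₁ r₂ := by rwa [Metric.mem_ball, dist_eq_norm] at hz
  have hw : |z.re - x₀| < min r₁ r₂ :=
    lt_of_le_of_lt (by simpa only [sub_re, ofReal_re] using abs_re_le_norm (z - x₀)) hzr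
  have hwt : ((z.re : ℝ) : ℂ) ∈ t := hr₁t (by
    rw [Metric.mem_ball, dist_eq_norm, ← ofReal_sub, norm_real, Real.norm_eq_abs]
    exact hw.trans_le (min_le_left _ _))
  have hzt : z ∈ t := hr₁t (by rw [Metric.mem_ball, dist_eq_norm]; exact hzr.trans_le (min_le_left _ _))
  have hkw : (k ((z.re : ℝ) : ℂ)).im = 0 := by
    by_cases h : z.re = x₀
    · rw [h]; exact hk0
    · exact hr₂real z.re (by rw [Real.dist_eq]; exact hw.trans_le (min_le_right _ _)) h
  have hsub : z - ((z.re : ℝ) : ℂ) = (z.im : ℂ) * I := Complex.ext (by simp) (by simp)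
  calc |(k z).im| = |(k z - k ((z.re : ℝ) : ℂ)).im| := by rw [sub_im, hkw, sub_zero]
    _ ≤ ‖k z - k ((z.re : ℝ) : ℂ)‖ := abs_im_le_norm _
    _ ≤ K * ‖z - ((z.re : ℝ) : ℂ)‖ := hK.norm_sub_le hzt hwt
    _ = K * |z.im| := by rw [hsub, norm_mul, norm_I, mul_one, norm_real, Real.norm_eq_abs]

/-! ## §2 The recombined diagonal four-term -/

/-- `‖T^{−(z − z̄)}‖ = 1` (`T > 0`; the exponent is purely imaginary). [folklore] -/
theorem norm_cpow_neg_sub_conj {T : ℝ} (hT : 0 < T) (z : ℂ) : ‖(T : ℂ) ^ (-(z - conj z))‖ = 1 := by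
  rw [norm_cpow_eq_rpow_re_of_pos hT]
  simp

/-- `z ↦ T^{−(z − z̄)} = exp(−(z − z̄)·log T)` is `ℝ`-smooth (`T > 0`). [folklore] -/
theorem contDiff_cpow_neg_sub_conj {T : ℝ} (hT : 0 < T) : ContDiff ℝ 1 (fun z : ℂ => (T : ℂ) ^ (-(z - conj z))) := by
  have hT0 : (T : ℂ) ≠ 0 := ofReal_ne_zero.2 hT.ne'
  have h1 : (fun z : ℂ => (T : ℂ) ^ (-(z - conj z))) = fun z : ℂ => exp (log (T : ℂ) * (-(z - conj z))) :=
    funext fun z => cpow_def_of_ne_zero hT0 _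
  have hconj : ContDiff ℝ 1 (fun z : ℂ => conj z) := by
    have : (fun z : ℂ => conj z) = ⇑conjCLE := funext fun z => (conjCLE_apply z).symm
    rw [this]; exact conjCLE.contDiff
  rw [h1]
  exact contDiff_exp.comp (contDiff_const.mul (contDiff_id.sub hconj).neg)

/-- `‖(conj w − w)∕(z − z̄)‖ = |Im w|∕|Im z|`. [folklore] -/
theorem norm_conj_sub_self_div (w z : ℂ) : ‖(conj w - w) / (z - conj z)‖ = |w.im| / |z.im| := by
  have h1 : conj w - w = -(((2 * w.im : ℝ)) : ℂ) * I := Complex.ext (by simp) (by simp [two_mul]; ring)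
  have h2 : z - conj z = (((2 * z.im : ℝ)) : ℂ) * I := Complex.ext (by simp) (by simp [two_mul])
  rw [norm_div, h1, h2, norm_mul, norm_mul, norm_neg, norm_I, mul_one, mul_one, norm_real, norm_real, Real.norm_eq_abs, Real.norm_eq_abs,
    abs_mul, abs_mul, abs_two, mul_div_mul_left _ _ (two_ne_zero)]

/-- **THE EXACT RECOMBINATION OF THE DIAGONAL FOUR-TERM**: with `k := T^{−(z−z̄)}·c`,
`R(z, z; c) = Cμ·CK·κ·m·φ₀·conj φ₀ · ( T^{z+z̄−2}∕(z+z̄−2) + (conj k − k)∕(z − z̄) − T^{−(z+z̄−2)}∕(z+z̄−2)·c·conj c )` — the two `1∕(z − z̄)` summands of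
★ `normSq_family_eq_fourTerm_on'` combined. [cite: MoeglinWaldspurger1995, IV.2.3] -/
theorem fourTerm_diag_eq (Cμ CK κ m : ℝ) {T : ℝ} (hT : 0 < T) (φ₀ : ℂ) (c z : ℂ) :
    ((Cμ : ℝ) : ℂ) * (((CK : ℝ) : ℂ) *
        ((((T : ℝ) : ℂ) ^ (z + conj z - 2) / (z + conj z - 2)) * (((κ : ℝ) : ℂ) * (((m : ℝ) : ℂ) * (φ₀ * conj φ₀)))
          + (((T : ℝ) : ℂ) ^ (z - conj z) / (z - conj z)) * (((κ : ℝ) : ℂ) * (((m : ℝ) : ℂ) * (φ₀ * conj (c * φ₀))))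
          - (((T : ℝ) : ℂ) ^ (-(z - conj z)) / (z - conj z)) * (((κ : ℝ) : ℂ) * (((m : ℝ) : ℂ) * (c * φ₀ * conj φ₀)))
          - (((T : ℝ) : ℂ) ^ (-(z + conj z - 2)) / (z + conj z - 2)) * (((κ : ℝ) : ℂ) * (((m : ℝ) : ℂ) * (c * φ₀ * conj (c * φ₀)))))) =
      (((Cμ : ℝ) : ℂ) * (((CK : ℝ) : ℂ) * (((κ : ℝ) : ℂ) * (((m : ℝ) : ℂ) * (φ₀ * conj φ₀))))) *
        (((T : ℝ) : ℂ) ^ (z + conj z - 2) / (z + conj z - 2)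
          + (conj (((T : ℝ) : ℂ) ^ (-(z - conj z)) * c) - ((T : ℝ) : ℂ) ^ (-(z - conj z)) * c) / (z - conj z)
          - ((T : ℝ) : ℂ) ^ (-(z + conj z - 2)) / (z + conj z - 2) * (c * conj c)) := by
  have hc1 : conj (((T : ℝ) : ℂ) ^ (-(z - conj z)) * c) = ((T : ℝ) : ℂ) ^ (z - conj z) * conj c := by
    rw [map_mul, conj_ofReal_cpow hT.le, map_neg, map_sub, conj_conj, neg_sub]
  rw [hc1, map_mul]
  simp only [div_eq_mul_inv]
  ring

/-- **THE NORM OF THE DIAGONAL FOUR-TERM**, off the real axis: `‖R(z, z; c)‖ ≤ ‖Cμ CK κ m φ₀ conj φ₀‖·( ‖T^{z+z̄−2}∕(z+z̄−2)‖ + |Im k z|∕|Im z| + ‖T^{−(z+z̄−2)}∕(z+z̄−2)‖·‖c‖² )`,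
`k z = T^{−(z−z̄)}·c`. [cite: MoeglinWaldspurger1995, IV.2.3] -/
theorem norm_fourTerm_diag_le (Cμ CK κ m : ℝ) {T : ℝ} (hT : 0 < T) (φ₀ : ℂ) (c z : ℂ) :
    ‖((Cμ : ℝ) : ℂ) * (((CK : ℝ) : ℂ) *
        ((((T : ℝ) : ℂ) ^ (z + conj z - 2) / (z + conj z - 2)) * (((κ : ℝ) : ℂ) * (((m : ℝ) : ℂ) * (φ₀ * conj φ₀)))
          + (((T : ℝ) : ℂ) ^ (z - conj z) / (z - conj z)) * (((κ : ℝ) : ℂ) * (((m : ℝ) : ℂ) * (φ₀ * conj (c * φ₀))))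
          - (((T : ℝ) : ℂ) ^ (-(z - conj z)) / (z - conj z)) * (((κ : ℝ) : ℂ) * (((m : ℝ) : ℂ) * (c * φ₀ * conj φ₀)))
          - (((T : ℝ) : ℂ) ^ (-(z + conj z - 2)) / (z + conj z - 2)) * (((κ : ℝ) : ℂ) * (((m : ℝ) : ℂ) * (c * φ₀ * conj (c * φ₀))))))‖ ≤
      ‖((Cμ : ℝ) : ℂ) * (((CK : ℝ) : ℂ) * (((κ : ℝ) : ℂ) * (((m : ℝ) : ℂ) * (φ₀ * conj φ₀))))‖ *
        (‖((T : ℝ) : ℂ) ^ (z + conj z - 2) / (z + conj z - 2)‖ + |(((T : ℝ) : ℂ) ^ (-(z - conj z)) * c).im| / |z.im|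
          + ‖((T : ℝ) : ℂ) ^ (-(z + conj z - 2)) / (z + conj z - 2)‖ * ‖c‖ ^ 2) := by
  rw [fourTerm_diag_eq Cμ CK κ m hT φ₀ c z, norm_mul]
  refine mul_le_mul_of_nonneg_left ?_ (norm_nonneg _)
  refine (norm_sub_le _ _).trans (add_le_add ((norm_add_le _ _).trans (add_le_add le_rfl ?_)) ?_)
  · rw [norm_conj_sub_self_div]
  · rw [norm_mul, norm_mul, RCLike.norm_conj, sq]

/-! ## §3 The two bounds: near any `z₀` with `1 < Re z₀` where `c̃` is analytic, and the weighted bound at `2` -/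

/-- The two outer coefficients `T^{±(z+z̄−2)}∕(z+z̄−2)` are bounded near every `z₀` with `1 < Re z₀` (continuity on `{1 < Re}`, where `z + z̄ − 2 = 2(Re z − 1) ≠ 0`).
[folklore] -/
theorem exists_norm_outer_le {T : ℝ} (hT : 0 < T) {z₀ : ℂ} (hz₀ : 1 < z₀.re) :
    ∃ B : ℝ, ∀ᶠ z in 𝓝 z₀, ‖((T : ℝ) : ℂ) ^ (z + conj z - 2) / (z + conj z - 2)‖ ≤ B ∧ ‖((T : ℝ) : ℂ) ^ (-(z + conj z - 2)) / (z + conj z - 2)‖ ≤ B := by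
  set S : Set ℂ := {z : ℂ | 1 < z.re} with hSdef
  have hSo : IsOpen S := isOpen_lt continuous_const continuous_re
  have hT0 : ((T : ℝ) : ℂ) ≠ 0 := ofReal_ne_zero.2 hT.ne'
  have hne : ∀ z ∈ S, z + conj z - 2 ≠ 0 := fun z hz h => by
    have := congrArg Complex.re h
    simp only [sub_re, add_re, conj_re, re_ofNat, zero_re] at this
    have hz' : 1 < z.re := hz
    linarith
  have hd : ContinuousOn (fun z : ℂ => z + conj z - 2) S := ((continuous_id.add continuous_conj).sub continuous_const).continuousOn
  have e₁ : ContinuousOn (fun z : ℂ => ((T : ℝ) : ℂ) ^ (z + conj z - 2) / (z + conj z - 2)) S := (hd.const_cpow (Or.inl hT0)).div hd hne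
  have e₄ : ContinuousOn (fun z : ℂ => ((T : ℝ) : ℂ) ^ (-(z + conj z - 2)) / (z + conj z - 2)) S := (hd.neg.const_cpow (Or.inl hT0)).div hd hne
  obtain ⟨r, hr0, hrS⟩ := Metric.nhds_basis_closedBall.mem_iff.1 (hSo.mem_nhds (show z₀ ∈ S from hz₀))
  obtain ⟨B₁, hB₁⟩ := (isCompact_closedBall z₀ r).exists_bound_of_continuousOn (e₁.mono hrS)
  obtain ⟨B₄, hB₄⟩ := (isCompact_closedBall z₀ r).exists_bound_of_continuousOn (e₄.mono hrS)
  refine ⟨max B₁ B₄, ?_⟩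
  filter_upwards [Metric.closedBall_mem_nhds z₀ hr0] with z hz
  exact ⟨(hB₁ z hz).trans (le_max_left _ _), (hB₄ z hz).trans (le_max_right _ _)⟩

/-- The middle quotient `|Im k z|∕|Im z|`, `k = T^{−(z−z̄)}·c`, is bounded near `z₀` off the real axis: at a REAL `z₀` by §1 (when `c` is `C¹` at `z₀` and real on the punctured real
trace), at a NON-REAL `z₀` trivially (`|Im k| ≤ ‖k‖ = ‖c‖`, `|Im z| ≥ |Im z₀|∕2`). [folklore] -/
theorem exists_abs_im_div_le {T : ℝ} (hT : 0 < T) {c : ℂ → ℂ} {z₀ : ℂ} (hc : ContDiffAt ℝ 1 c z₀)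
    (hreal : z₀.im = 0 → ∀ᶠ x : ℝ in 𝓝[≠] z₀.re, (c (x : ℂ)).im = 0) :
    ∃ C₁ : ℝ, ∀ᶠ z in 𝓝 z₀, z.im ≠ 0 → |(((T : ℝ) : ℂ) ^ (-(z - conj z)) * c z).im| / |z.im| ≤ C₁ := by
  by_cases h0 : z₀.im = 0
  · have hz₀eq : ((z₀.re : ℝ) : ℂ) = z₀ := Complex.ext (by simp) (by simp [h0])
    have hk : ContDiffAt ℝ 1 (fun z : ℂ => ((T : ℝ) : ℂ) ^ (-(z - conj z)) * c z) ((z₀.re : ℝ) : ℂ) := by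
      rw [hz₀eq]; exact (contDiff_cpow_neg_sub_conj hT).contDiffAt.mul hc
    have hkreal : ∀ᶠ x : ℝ in 𝓝[≠] z₀.re, ((fun z : ℂ => ((T : ℝ) : ℂ) ^ (-(z - conj z)) * c z) (x : ℂ)).im = 0 := by
      filter_upwards [hreal h0] with x hx
      simp only [conj_ofReal, sub_self, neg_zero, cpow_zero, one_mul]
      exact hx
    obtain ⟨C₁, hC₁⟩ := exists_abs_im_le_mul_abs_im hk hkreal
    rw [hz₀eq] at hC₁
    refine ⟨C₁, ?_⟩
    filter_upwards [hC₁] with z hz hzim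
    rw [div_le_iff₀ (abs_pos.2 hzim)]
    exact hz
  · obtain ⟨M, hM⟩ : ∃ M : ℝ, ∀ᶠ z in 𝓝 z₀, ‖c z‖ ≤ M :=
      ⟨‖c z₀‖ + 1, (hc.continuousAt.norm.eventually (Iic_mem_nhds (lt_add_one ‖c z₀‖))).mono fun z hz => hz⟩
    have hM0 : 0 ≤ M := by obtain ⟨z, hz⟩ := hM.exists; exact (norm_nonneg _).trans hz
    have him : ∀ᶠ z in 𝓝 z₀, |z₀.im| / 2 ≤ |z.im| := by
      have h1 : ∀ᶠ z in 𝓝 z₀, dist z.im z₀.im < |z₀.im| / 2 :=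
        (continuous_im.tendsto z₀) (Metric.ball_mem_nhds _ (half_pos (abs_pos.2 h0)))
      filter_upwards [h1] with z hz
      rw [Real.dist_eq] at hz
      have := abs_sub_abs_le_abs_sub z₀.im z.im
      rw [abs_sub_comm] at this
      linarith
    refine ⟨M / (|z₀.im| / 2), ?_⟩
    filter_upwards [hM, him] with z hzM hzi hzim
    have h1 : |(((T : ℝ) : ℂ) ^ (-(z - conj z)) * c z).im| ≤ M :=
      (abs_im_le_norm _).trans (by rw [norm_mul, norm_cpow_neg_sub_conj hT, one_mul]; exact hzM)
    calc |(((T : ℝ) : ℂ) ^ (-(z - conj z)) * c z).im| / |z.im| ≤ M / |z.im| := div_le_div_of_nonneg_right h1 (abs_pos.2 hzim).le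
      _ ≤ M / (|z₀.im| / 2) := div_le_div_of_nonneg_left hM0 (half_pos (abs_pos.2 h0)) hzi

/-- **THE DIAGONAL FOUR-TERM IS BOUNDED NEAR EVERY `z₀` WITH `1 < Re z₀` AT WHICH `c̃` IS ANALYTIC** — off the real axis near `z₀`; if `z₀` is real, `c̃` is asked to be real at the real
points `x ≠ Re z₀` near it (reflection principle).  The `1∕|Im z|` of the two middle summands cancels (§2 + §1). [cite: MoeglinWaldspurger1995, IV.2.3, IV.3.12 (a)]
[cite: Arthur1980TraceFormulaII, §4] -/
theorem exists_norm_fourTerm_diag_le (Cμ CK κ m : ℝ) {T : ℝ} (hT : 0 < T) (φ₀ : ℂ) {c : ℂ → ℂ} {z₀ : ℂ} (hz₀ : 1 < z₀.re)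
    (hc : AnalyticAt ℂ c z₀) (hreal : z₀.im = 0 → ∀ᶠ x : ℝ in 𝓝[≠] z₀.re, (c (x : ℂ)).im = 0) :
    ∃ C : ℝ, ∀ᶠ z in 𝓝 z₀, z.im ≠ 0 →
      ‖((Cμ : ℝ) : ℂ) * (((CK : ℝ) : ℂ) *
        ((((T : ℝ) : ℂ) ^ (z + conj z - 2) / (z + conj z - 2)) * (((κ : ℝ) : ℂ) * (((m : ℝ) : ℂ) * (φ₀ * conj φ₀)))
          + (((T : ℝ) : ℂ) ^ (z - conj z) / (z - conj z)) * (((κ : ℝ) : ℂ) * (((m : ℝ) : ℂ) * (φ₀ * conj (c z * φ₀))))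
          - (((T : ℝ) : ℂ) ^ (-(z - conj z)) / (z - conj z)) * (((κ : ℝ) : ℂ) * (((m : ℝ) : ℂ) * (c z * φ₀ * conj φ₀)))
          - (((T : ℝ) : ℂ) ^ (-(z + conj z - 2)) / (z + conj z - 2)) * (((κ : ℝ) : ℂ) * (((m : ℝ) : ℂ) * (c z * φ₀ * conj (c z * φ₀))))))‖ ≤ C := by
  obtain ⟨B, hB⟩ := exists_norm_outer_le hT hz₀
  obtain ⟨C₁, hC₁⟩ := exists_abs_im_div_le hT (hc.contDiffAt.restrict_scalars ℝ) hreal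
  obtain ⟨M, hM⟩ : ∃ M : ℝ, ∀ᶠ z in 𝓝 z₀, ‖c z‖ ≤ M :=
    ⟨‖c z₀‖ + 1, (hc.continuousAt.norm.eventually (Iic_mem_nhds (lt_add_one ‖c z₀‖))).mono fun z hz => hz⟩
  set K₀ : ℝ := ‖((Cμ : ℝ) : ℂ) * (((CK : ℝ) : ℂ) * (((κ : ℝ) : ℂ) * (((m : ℝ) : ℂ) * (φ₀ * conj φ₀))))‖ with hK₀
  refine ⟨K₀ * (B + C₁ + B * M ^ 2), ?_⟩
  filter_upwards [hB, hC₁, hM] with z hzB hzC hzM hzim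
  refine (norm_fourTerm_diag_le Cμ CK κ m hT φ₀ (c z) z).trans (mul_le_mul_of_nonneg_left ?_ (norm_nonneg _))
  have hB0 : 0 ≤ B := (norm_nonneg _).trans hzB.1
  exact add_le_add (add_le_add hzB.1 (hzC hzim)) (mul_le_mul hzB.2 (pow_le_pow_left₀ (norm_nonneg _) hzM 2) (sq_nonneg _) hB0)

/-- **THE `|z − 2|²`-WEIGHTED DIAGONAL FOUR-TERM IS BOUNDED NEAR `z₀ = 2`** (off the real axis), where `c̃` has a simple pole: `(z − 2)·c̃ = d` near `2` with `d` analytic at `2`, and `c̃`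
real at the real points `x ≠ 2` near `2`.  With `k₂ := conj(z−2)·T^{−(z−z̄)}·d` (real on the real axis, `C¹`): `|z−2|²·|Im k| = |Im k₂| ≤ C|Im z|`; the outer terms carry `|z−2|² ≤ 1` and
`|(z−2)c̃|² = |d|²`.  This is (MS-2)'s scalar heart. [cite: MoeglinWaldspurger1995, IV.2.3, IV.3.12 (a)] [cite: Arthur1980TraceFormulaII, §4] -/
theorem exists_normSq_mul_norm_fourTerm_diag_le_two (Cμ CK κ m : ℝ) {T : ℝ} (hT : 0 < T) (φ₀ : ℂ) {c d : ℂ → ℂ}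
    (hd : AnalyticAt ℂ d 2) (hdc : ∀ᶠ z in 𝓝[≠] (2 : ℂ), d z = (z - 2) * c z) (hreal : ∀ᶠ x : ℝ in 𝓝[≠] (2 : ℝ), (c (x : ℂ)).im = 0) :
    ∃ C : ℝ, ∀ᶠ z in 𝓝[≠] (2 : ℂ), z.im ≠ 0 →
      ‖z - 2‖ ^ 2 * ‖((Cμ : ℝ) : ℂ) * (((CK : ℝ) : ℂ) *
        ((((T : ℝ) : ℂ) ^ (z + conj z - 2) / (z + conj z - 2)) * (((κ : ℝ) : ℂ) * (((m : ℝ) : ℂ) * (φ₀ * conj φ₀)))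
          + (((T : ℝ) : ℂ) ^ (z - conj z) / (z - conj z)) * (((κ : ℝ) : ℂ) * (((m : ℝ) : ℂ) * (φ₀ * conj (c z * φ₀))))
          - (((T : ℝ) : ℂ) ^ (-(z - conj z)) / (z - conj z)) * (((κ : ℝ) : ℂ) * (((m : ℝ) : ℂ) * (c z * φ₀ * conj φ₀)))
          - (((T : ℝ) : ℂ) ^ (-(z + conj z - 2)) / (z + conj z - 2)) * (((κ : ℝ) : ℂ) * (((m : ℝ) : ℂ) * (c z * φ₀ * conj (c z * φ₀))))))‖ ≤ C := by
  -- the outer coefficients near `2`, `d` bounded near `2`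
  obtain ⟨B, hB⟩ := exists_norm_outer_le hT (show 1 < (2 : ℂ).re by norm_num)
  obtain ⟨M, hM⟩ : ∃ M : ℝ, ∀ᶠ z in 𝓝 (2 : ℂ), ‖d z‖ ≤ M :=
    ⟨‖d 2‖ + 1, (hd.continuousAt.norm.eventually (Iic_mem_nhds (lt_add_one ‖d 2‖))).mono fun z hz => hz⟩
  -- `k₂ := conj(z−2)·T^{−(z−z̄)}·d` is `C¹` at `2` and real on the punctured real trace
  have hk₂ : ContDiffAt ℝ 1 (fun z : ℂ => conj (z - 2) * (((T : ℝ) : ℂ) ^ (-(z - conj z)) * d z)) (((2 : ℝ)) : ℂ) := by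
    have hconj : ContDiff ℝ 1 (fun z : ℂ => conj z) := by
      have : (fun z : ℂ => conj z) = ⇑conjCLE := funext fun z => (conjCLE_apply z).symm
      rw [this]; exact conjCLE.contDiff
    rw [ofReal_ofNat]
    exact (hconj.comp (contDiff_id.sub contDiff_const)).contDiffAt.mul (((contDiff_cpow_neg_sub_conj hT).contDiffAt).mul (hd.contDiffAt.restrict_scalars ℝ))
  have hdc' : ∀ᶠ x : ℝ in 𝓝[≠] (2 : ℝ), d (x : ℂ) = ((x : ℂ) - 2) * c (x : ℂ) := by
    have ht : Tendsto (fun x : ℝ => (x : ℂ)) (𝓝[≠] (2 : ℝ)) (𝓝[≠] (2 : ℂ)) := by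
      refine tendsto_nhdsWithin_of_tendsto_nhds_of_eventually_within _ ((continuous_ofReal.tendsto' 2 2 (by simp)).mono_left nhdsWithin_le_nhds) ?_
      filter_upwards [self_mem_nhdsWithin] with x hx
      simpa only [mem_compl_iff, mem_singleton_iff, ne_eq, ← ofReal_ofNat, ofReal_inj] using hx
    exact ht.eventually hdc
  have hk₂real : ∀ᶠ x : ℝ in 𝓝[≠] (2 : ℝ), ((fun z : ℂ => conj (z - 2) * (((T : ℝ) : ℂ) ^ (-(z - conj z)) * d z)) (x : ℂ)).im = 0 := by
    filter_upwards [hreal, hdc'] with x hx hxd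
    simp only [hxd, conj_ofReal, sub_self, neg_zero, cpow_zero, one_mul, ← ofReal_ofNat, ← ofReal_sub, mul_im, ofReal_re, ofReal_im, hx]
    ring
  obtain ⟨C₁, hC₁⟩ := exists_abs_im_le_mul_abs_im hk₂ hk₂real
  rw [ofReal_ofNat] at hC₁
  set K₀ : ℝ := ‖((Cμ : ℝ) : ℂ) * (((CK : ℝ) : ℂ) * (((κ : ℝ) : ℂ) * (((m : ℝ) : ℂ) * (φ₀ * conj φ₀))))‖ with hK₀
  refine ⟨K₀ * (B + C₁ + B * M ^ 2), ?_⟩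
  have hball : ∀ᶠ z in 𝓝[≠] (2 : ℂ), ‖z - 2‖ ≤ 1 := by
    filter_upwards [mem_nhdsWithin_of_mem_nhds (Metric.closedBall_mem_nhds (2 : ℂ) one_pos)] with z hz
    rwa [Metric.mem_closedBall, dist_eq_norm] at hz
  filter_upwards [mem_nhdsWithin_of_mem_nhds hB, mem_nhdsWithin_of_mem_nhds hC₁, mem_nhdsWithin_of_mem_nhds hM, hdc, hball] with z hzB hzC hzM hzd hz1 hzim
  have hB0 : 0 ≤ B := (norm_nonneg _).trans hzB.1
  have hsq : ‖z - 2‖ ^ 2 ≤ 1 := by nlinarith [norm_nonneg (z - 2)]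
  -- `|z−2|²·|Im k| = |Im k₂|`
  have hk₂eq : (((‖z - 2‖ ^ 2 : ℝ)) : ℂ) * (((T : ℝ) : ℂ) ^ (-(z - conj z)) * c z) = conj (z - 2) * (((T : ℝ) : ℂ) ^ (-(z - conj z)) * d z) := by
    rw [hzd, ofReal_pow, ← conj_mul' (z - 2)]; ring
  have hmid : ‖z - 2‖ ^ 2 * (|(((T : ℝ) : ℂ) ^ (-(z - conj z)) * c z).im| / |z.im|) ≤ C₁ := by
    rw [← mul_div_assoc, div_le_iff₀ (abs_pos.2 hzim), ← abs_of_nonneg (sq_nonneg ‖z - 2‖), ← abs_mul, ← im_ofReal_mul, hk₂eq]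
    exact hzC
  calc ‖z - 2‖ ^ 2 * _ ≤ ‖z - 2‖ ^ 2 * (K₀ * (‖((T : ℝ) : ℂ) ^ (z + conj z - 2) / (z + conj z - 2)‖ + |(((T : ℝ) : ℂ) ^ (-(z - conj z)) * c z).im| / |z.im|
          + ‖((T : ℝ) : ℂ) ^ (-(z + conj z - 2)) / (z + conj z - 2)‖ * ‖c z‖ ^ 2)) :=
        mul_le_mul_of_nonneg_left (norm_fourTerm_diag_le Cμ CK κ m hT φ₀ (c z) z) (sq_nonneg _)
    _ = K₀ * (‖z - 2‖ ^ 2 * ‖((T : ℝ) : ℂ) ^ (z + conj z - 2) / (z + conj z - 2)‖ + ‖z - 2‖ ^ 2 * (|(((T : ℝ) : ℂ) ^ (-(z - conj z)) * c z).im| / |z.im|)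
          + ‖((T : ℝ) : ℂ) ^ (-(z + conj z - 2)) / (z + conj z - 2)‖ * (‖z - 2‖ * ‖c z‖) ^ 2) := by ring
    _ ≤ K₀ * (B + C₁ + B * M ^ 2) := by
        refine mul_le_mul_of_nonneg_left (add_le_add (add_le_add ?_ hmid) ?_) (norm_nonneg _)
        · exact (mul_le_mul hsq hzB.1 (norm_nonneg _) zero_le_one).trans_eq (one_mul B)
        · refine mul_le_mul hzB.2 (pow_le_pow_left₀ (by positivity) ?_ 2) (sq_nonneg _) hB0
          rw [← norm_mul, ← hzd]; exact hzM

/-! ## §4 Closure across the real axis -/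

/-- **AN EVENTUAL BOUND OFF THE REAL AXIS IS AN EVENTUAL BOUND**: if `G` is continuous on an open `V`, `z ∈ V` eventually along `𝓝[≠] z₀`, and `‖G z‖ ≤ C` eventually for
non-real `z`, then `‖G z‖ ≤ C` eventually — a real `z` is approached by `z + it`, `t → 0⁺`. [folklore] -/
theorem eventually_norm_le_of_im_ne_zero {E : Type*} [NormedAddCommGroup E] {G : ℂ → E} {V : Set ℂ} (hV : IsOpen V) (hG : ContinuousOn G V)
    {z₀ : ℂ} {C : ℝ} (hmem : ∀ᶠ z in 𝓝[≠] z₀, z ∈ V) (hb : ∀ᶠ z in 𝓝[≠] z₀, z.im ≠ 0 → ‖G z‖ ≤ C) :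
    ∀ᶠ z in 𝓝[≠] z₀, ‖G z‖ ≤ C := by
  obtain ⟨ε, hε, hεsub⟩ := Metric.mem_nhdsWithin_iff.1 (hmem.and hb)
  refine Metric.mem_nhdsWithin_iff.2 ⟨ε, hε, fun z hz => ?_⟩
  obtain ⟨hzV, hzb⟩ := hεsub hz
  rcases ne_or_eq z.im 0 with hzi | hzi
  · exact hzb hzi
  · have hcont : ContinuousAt G z := hG.continuousAt (hV.mem_nhds hzV)
    have hpath : Tendsto (fun t : ℝ => z + (t : ℂ) * I) (𝓝[>] (0 : ℝ)) (𝓝 z) := by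
      have hc : Continuous (fun t : ℝ => z + (t : ℂ) * I) := continuous_const.add (continuous_ofReal.mul continuous_const)
      have := hc.tendsto 0
      simp only [ofReal_zero, zero_mul, add_zero] at this
      exact this.mono_left nhdsWithin_le_nhds
    have hlim : Tendsto (fun t : ℝ => ‖G (z + (t : ℂ) * I)‖) (𝓝[>] (0 : ℝ)) (𝓝 ‖G z‖) :=
      (continuous_norm.continuousAt.tendsto.comp (hcont.tendsto.comp hpath))
    have hev : ∀ᶠ t : ℝ in 𝓝[>] (0 : ℝ), ‖G (z + (t : ℂ) * I)‖ ≤ C := by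
      have hopen : Metric.ball z₀ ε ∩ {z₀}ᶜ ∈ 𝓝 z := (Metric.isOpen_ball.inter isOpen_compl_singleton).mem_nhds hz
      filter_upwards [hpath hopen, self_mem_nhdsWithin] with t ht ht0
      have ht0' : (0 : ℝ) < t := ht0
      exact (hεsub ht).2 (by simp [hzi, ht0'.ne'])
    exact le_of_tendsto hlim hev

end Summit.HodgeConjecture.HodgeConjecture.Cruxes.H413.K2E1MaassSelbergDiagonalRealAxisCMThree

end
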